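import Mathlib.GroupTheory.Abelianization.Defs
import Mathlib.Algebra.Ring.GeomSum
import Mathlib.Data.ZMod.Basic
import Mathlib.Algebra.Group.Subgroup.Basic
import Mathlib.Tactic.Abel
import Mathlib.Tactic.Ring
import Mathlib.Tactic.IntervalCases
import HarnessLib

set_option linter.dupNamespace false

/-!
# Weil-type family coverage — TYPE-III WINDOWS, part F (census block b04.21): the ALGEBRAIC SKELETON of THEOREM S22 (the twist law)

research route conditional on HC_CM; not a corollary; Q11.4-sentence-2 already refuted in dim ≥ 3.

Ring 2, WEIL-TYPE FAMILY-COVERAGE CENSUS (`HOME/WEIL-FAMILY-COVERAGE.md` `## b04`, block b04.21, owner ring2-b04, gen 57; theory note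
`HOME/pub-hodge-ring2-b04/census-g57/theory/THEOREMS-S22.md`).  SETTING (informal, not formalised): for a type-III carrier `(G, χ)` and an odd
prime `ℓ` with `D(χ)_ℓ` split, THEOREM S21 (part E, `Ring2WeilCoverageWittCocycle`) gives a unique odd class function `u : G → W(ℚ_ℓ)` whose
coboundary is the three-point Witt class; THEOREM S22 says that the GALOIS TWIST `c ↦ c^{(k)}` (k-th power map on classes) acts on `u` as
multiplication by the class `⟨λ_k⟩` of the cyclotomic character: `u(x^k) = ⟨λ_k⟩ · u(x)`, whence `σ_ℓ(c^{(k)}) = σ_ℓ(c)·(k/ℓ)^{e_ℓ(c)}`.  Its proof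
has an arithmetic input (branch cycle argument + Galois equivariance of the Weil pairing: the twisted datum's class is `⟨λ⟩` times the
original one) and a purely algebraic skeleton, which THIS FILE checks in the kernel with abstract `G` (group) and `A` (additive commutative group,
standing for `W(ℚ_ℓ)`), `L : A →+ A` (standing for `x ↦ ⟨λ⟩x`) and `t : G → G` (standing for `x ↦ x^k`): (1) the difference
`v = u ∘ t − L ∘ u` is ADDITIVE as soon as the twisted three-point classes are `L` of the untwisted ones; (2) an additive map on a PERFECT group
vanishes (it factors through the abelianisation) — so `u ∘ t = L ∘ u`; (3) an additive map on a group of exponent `n` into a group without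
`n`-torsion vanishes (uniqueness of the cyclic reduction S21 (f) / S22 §3 for odd `n`); (4) the INDICATOR COCHAIN of a subgroup has the
three-point indicator as coboundary when `2κ = 0` (the shift `u(g^k) = u(g) + e_ℓ(c)κ_ℓ` of S22 §3 (v)); (5) the cyclotomic residue
`(ζ^{2k} − 1)/(ζ² − 1) ≡ k (mod ζ − 1)` behind the norm-residue symbol `(k/ℓ)` of S22 §3 (iv); (6) the quadratic-residue facts that turn S22
into the census's sign predictions (`2I`, `2.A_6` at 5; `SL₂(13)` at 13 = PREDICTION P10; `U₃(4)` at 13 = PREDICTION P11; `SL₂(17)`/`SL₂(19)` at 3).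

No `def`, no named fact, no `sorry`; nothing here is a statement about Hodge classes; `HC_CM` is used nowhere.
-/

namespace Summit.HodgeConjecture.HodgeConjecture.Ring2.WeilCoverage

variable {G A : Type*} [Group G] [AddCommGroup A]

/-- TWIST DIFFERENCE IS ADDITIVE (THEOREM S22 (b), census b04.21): if the twisted three-point classes are the images under the additive map
`L` (multiplication by `⟨λ⟩` in `W(ℚ_ℓ)`) of the untwisted ones — `u(t x) + u(t y) − u(t(xy)) = L(u x + u y − u(xy))`, which is what the
branch cycle argument + Weil-pairing equivariance + S21 additivity give for `t = (· ^ k)` — then `v := u ∘ t − L ∘ u` is additive.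
research route conditional on HC_CM; not a corollary; Q11.4-sentence-2 already refuted in dim ≥ 3. -/
theorem twistLaw_difference_additive (u : G → A) (L : A →+ A) (t : G → G)
    (h : ∀ x y : G, u (t x) + u (t y) - u (t (x * y)) = L (u x + u y - u (x * y))) (x y : G) :
    (u (t (x * y)) - L (u (x * y))) = (u (t x) - L (u x)) + (u (t y) - L (u y)) := by
  have hx := h x y
  rw [map_sub, map_add] at hx
  calc u (t (x * y)) - L (u (x * y))
      = (u (t x) + u (t y) - (u (t x) + u (t y) - u (t (x * y)))) - L (u (x * y)) := by abel
    _ = (u (t x) + u (t y) - (L (u x) + L (u y) - L (u (x * y)))) - L (u (x * y)) := by rw [hx]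
    _ = (u (t x) - L (u x)) + (u (t y) - L (u y)) := by abel

/-- ADDITIVE MAPS ON A PERFECT GROUP VANISH (THEOREM S22 (b), uniqueness step; census b04.21): a homomorphism from a group whose commutator
subgroup is everything to a commutative group is trivial.  Applied to `v = u ∘ (·^k) − ⟨λ⟩u` this gives `u(x^k) = ⟨λ⟩u(x)` for every element —
the twist law for ALL classes of the perfect carriers of record (`SL₂(q)`, `U₃(3)`, `Sp₄(3)`, `U₃(5)`, `2.A₆`).
research route conditional on HC_CM; not a corollary; Q11.4-sentence-2 already refuted in dim ≥ 3. -/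
theorem twistLaw_hom_trivial_of_perfect {M : Type*} [CommGroup M] (f : G →* M) (hperf : commutator G = ⊤) (g : G) :
    f g = 1 := by
  have hle : commutator G ≤ f.ker := Abelianization.commutator_subset_ker f
  rw [hperf, top_le_iff] at hle
  have hg : g ∈ f.ker := by rw [hle]; exact Subgroup.mem_top g
  exact (MonoidHom.mem_ker).mp hg

/-- THE TWIST LAW, ABSTRACT FORM (THEOREM S22 (b), census b04.21): on a perfect group, a function `u : G → A` whose twisted three-point
classes are `L` of the untwisted ones satisfies `u (t x) = L (u x)` for every `x` — in the census: `u_ℓ(c^{(k)}) = ⟨λ_k⟩·u_ℓ(c)`, hence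
`d(c^{(k)}) = d(c)` and `σ_ℓ(c^{(k)}) = σ_ℓ(c)(k/ℓ)^{e_ℓ(c)}` (PREDICTION P10 `σ₁₃(13A)σ₁₃(13B) = −1` for `SL₂(13)` is the instance
`e₁₃ = 1`, `(2/13) = −1`).
research route conditional on HC_CM; not a corollary; Q11.4-sentence-2 already refuted in dim ≥ 3. -/
theorem twistLaw_of_perfect (u : G → A) (L : A →+ A) (t : G → G) (hperf : commutator G = ⊤)
    (h : ∀ x y : G, u (t x) + u (t y) - u (t (x * y)) = L (u x + u y - u (x * y))) (x : G) :
    u (t x) = L (u x) := by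
  -- the difference as a monoid hom into `Multiplicative A`
  let f : G →* Multiplicative A :=
    { toFun := fun g => Multiplicative.ofAdd (u (t g) - L (u g))
      map_one' := by
        have h1 := twistLaw_difference_additive u L t h 1 1
        rw [mul_one] at h1
        have : u (t 1) - L (u 1) = 0 := by
          have e : (u (t 1) - L (u 1)) = (u (t 1) - L (u 1)) + (u (t 1) - L (u 1)) := h1
          have e2 : (u (t 1) - L (u 1)) + 0 = (u (t 1) - L (u 1)) + (u (t 1) - L (u 1)) := by rw [add_zero]; exact e
          exact (add_left_cancel e2).symm
        rw [this]; rfl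
      map_mul' := by
        intro a b
        rw [← ofAdd_add, twistLaw_difference_additive u L t h a b] }
  have hf := twistLaw_hom_trivial_of_perfect f hperf x
  have : u (t x) - L (u x) = 0 := by
    have e : Multiplicative.ofAdd (u (t x) - L (u x)) = Multiplicative.ofAdd (0 : A) := hf
    exact Multiplicative.ofAdd.injective e
  exact sub_eq_zero.mp this

/-- UNIQUENESS OF THE CYCLIC REDUCTION (THEOREM S21 (f) / S22 §3; census b04.21): an additive map `v` from a group of exponent `n` to an
additive group in which `n • a = 0` forces `a = 0` (e.g. `n` odd, `A = W(ℚ_ℓ)` a finite 2-group) vanishes; so the restriction of `u_ℓ` to a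
cyclic subgroup of ODD order is the unique solution of the cyclic cocycle equations, and Galois twisting can be analysed there.
research route conditional on HC_CM; not a corollary; Q11.4-sentence-2 already refuted in dim ≥ 3. -/
theorem twistLaw_additive_vanishes_of_exponent (v : G → A) (hadd : ∀ x y : G, v (x * y) = v x + v y) (n : ℕ)
    (hexp : ∀ x : G, x ^ n = 1) (htors : ∀ a : A, n • a = 0 → a = 0) (x : G) : v x = 0 := by
  have h1 : v 1 = 0 := by
    have e := hadd 1 1
    rw [mul_one] at e
    have e2 : v 1 + 0 = v 1 + v 1 := by rw [add_zero]; exact e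
    exact (add_left_cancel e2).symm
  have hpow : ∀ m : ℕ, v (x ^ m) = m • v x := by
    intro m
    induction m with
    | zero => rw [pow_zero, zero_smul, h1]
    | succ m ih => rw [pow_succ, hadd, ih, succ_nsmul]
  apply htors
  rw [← hpow n, hexp x, h1]

/-- THE INDICATOR COCHAIN (THEOREM S22 §3 (v); census b04.21): for a subgroup `H ≤ Z` and `κ` with `2 • κ = 0` (the anisotropic 4-class
`κ_ℓ ∈ I²(ℚ_ℓ)`, `ℓ ≡ 1 (4)`), the cochain `v(x) = 0` on `H`, `= κ` off `H`, has coboundary `v x + v y − v(xy) = κ` exactly when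
`x, y, xy ∉ H` and `0` otherwise — which is how the modified cyclic right-hand sides (every rank-one hermitian class of the `ℓ`-power piece
flipped) integrate to `u(g^k) = u(g) + a_{ℓ^j}(c)·κ_ℓ`.  Stated for the four membership cases.
research route conditional on HC_CM; not a corollary; Q11.4-sentence-2 already refuted in dim ≥ 3. -/
theorem twistLaw_indicator_cochain (H : Subgroup G) [DecidablePred (· ∈ H)] (κ : A) (h2 : (2 : ℕ) • κ = 0) (v : G → A)
    (hv_in : ∀ x, x ∈ H → v x = 0) (hv_out : ∀ x, x ∉ H → v x = κ) (x y : G) :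
    v x + v y - v (x * y) = (if x ∉ H ∧ y ∉ H ∧ x * y ∉ H then κ else 0) := by
  rw [two_nsmul] at h2
  by_cases hx : x ∈ H
  · by_cases hy : y ∈ H
    · have hxy : x * y ∈ H := H.mul_mem hx hy
      rw [hv_in x hx, hv_in y hy, hv_in _ hxy, if_neg (fun hc => hc.1 hx), add_zero, sub_zero]
    · have hxy : x * y ∉ H := fun hxy => hy (by simpa using H.mul_mem (H.inv_mem hx) hxy)
      rw [hv_in x hx, hv_out y hy, hv_out _ hxy, if_neg (fun hc => hc.1 hx), zero_add, sub_self]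
  · by_cases hy : y ∈ H
    · have hxy : x * y ∉ H := fun hxy => hx (by simpa using H.mul_mem hxy (H.inv_mem hy))
      rw [hv_out x hx, hv_in y hy, hv_out _ hxy, if_neg (fun hc => hc.2.1 hy), add_zero, sub_self]
    · by_cases hxy : x * y ∈ H
      · rw [hv_out x hx, hv_out y hy, hv_in _ hxy, if_neg (fun hc => hc.2.2 hxy), sub_zero, h2]
      · rw [hv_out x hx, hv_out y hy, hv_out _ hxy, if_pos ⟨hx, hy, hxy⟩, add_sub_cancel_right]

/-- THE CYCLOTOMIC RESIDUE (THEOREM S22 §3 (iv); census b04.21): in any commutative ring, `ζ − 1` divides `(1 + ζ² + ⋯ + ζ^{2(k−1)}) − k`;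
with `(ζ² − 1)(1 + ζ² + ⋯ + ζ^{2(k−1)}) = ζ^{2k} − 1` this says that the unit `(ζ^k − ζ^{−k})/(ζ − ζ^{−1})` of `ℚ(ζ_{ℓ^j})⁺` has residue `k`
at the prime above `ℓ` — so it is a local norm from `ℚ(ζ_{ℓ^j})` iff `k` is a square mod `ℓ`: the source of the Legendre symbol `(k/ℓ)`.
research route conditional on HC_CM; not a corollary; Q11.4-sentence-2 already refuted in dim ≥ 3. -/
theorem twistLaw_cyclotomic_residue {R : Type*} [CommRing R] (ζ : R) (k : ℕ) :
    (ζ - 1) ∣ (∑ i ∈ Finset.range k, ζ ^ (2 * i)) - (k : R) := by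
  induction k with
  | zero => simp
  | succ k ih =>
    rw [Finset.sum_range_succ, Nat.cast_succ]
    have e : (∑ i ∈ Finset.range k, ζ ^ (2 * i)) + ζ ^ (2 * k) - ((k : R) + 1)
        = ((∑ i ∈ Finset.range k, ζ ^ (2 * i)) - (k : R)) + (ζ ^ (2 * k) - 1) := by ring
    rw [e]
    exact dvd_add ih (sub_one_dvd_pow_sub_one ζ (2 * k))

/-- The companion identity `(ζ² − 1)·Σ_{i<k} ζ^{2i} = ζ^{2k} − 1` (geometric sum), census b04.21.
research route conditional on HC_CM; not a corollary; Q11.4-sentence-2 already refuted in dim ≥ 3. -/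
theorem twistLaw_cyclotomic_geom_sum {R : Type*} [CommRing R] (ζ : R) (k : ℕ) :
    (∑ i ∈ Finset.range k, ζ ^ (2 * i)) * (ζ ^ 2 - 1) = ζ ^ (2 * k) - 1 := by
  have h := geom_sum_mul (ζ ^ 2) k
  simp only [← pow_mul] at h
  rw [Nat.mul_comm 2 k]
  convert h using 3
  ring

/-- QUADRATIC-RESIDUE FACTS BEHIND THE SIGN PREDICTIONS (census b04.21, TABLE-S22): `2` is a non-residue mod `5` and mod `13` (so the twist
pairs `5A/5B` of `2I`, `2.A₆` and `13A/13B` of `SL₂(13)`, `c ↦ c^{(2)}`, carry OPPOSITE local signs when `e_ℓ = 1`: THEOREM S22.1, PREDICTION P10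
proved), `2` is a non-residue mod `3` (`9A^{(8)} = 9A` in `SL₂(17)`, `SL₂(19)` with `e₃` odd forces `3 ∈ Ram D`: S22.4), and `3, 9` are residues
mod `13` (the stabiliser `{1,3,9}` of the `U₃(4)` classes of order 13 lies in the squares, so the four classes split `2 + 2` under `σ₁₃`:
PREDICTION P11).
research route conditional on HC_CM; not a corollary; Q11.4-sentence-2 already refuted in dim ≥ 3. -/
theorem twistLaw_residue_facts :
    (∀ r : ZMod 5, r * r ≠ 2) ∧ (∀ r : ZMod 13, r * r ≠ 2) ∧ (∀ r : ZMod 3, r * r ≠ 2)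
      ∧ (4 : ZMod 13) * 4 = 3 ∧ (3 : ZMod 13) * 3 = 9 ∧ (2 : ZMod 5) * 2 = 4 := by
  refine ⟨by decide, by decide, by decide, by decide, by decide, by decide⟩

/-- SIGN BOOKKEEPING OF THE TWIST LAW (THEOREM S22 (b)/(W1); census b04.21): with signs written multiplicatively in a commutative group
(`σ' = σ · η^e`, `η = (k/ℓ) ∈ {±1}`, `η² = 1`), an EVEN exponent `e_ℓ(c)` gives equal signs and an ODD one gives `σ' = σ·η` — the two cases
«`ℓ ∤ ord c` or `e_ℓ(c)` even ⇒ equal» / «`e_ℓ(c)` odd ⇒ flip by `(k/ℓ)`» of S22.2/S22.1.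
research route conditional on HC_CM; not a corollary; Q11.4-sentence-2 already refuted in dim ≥ 3. -/
theorem twistLaw_sign_parity {M : Type*} [CommGroup M] (σ η : M) (hη : η * η = 1) (e : ℕ) :
    σ * η ^ (2 * e) = σ ∧ σ * η ^ (2 * e + 1) = σ * η := by
  have h2 : η ^ 2 = 1 := by rw [pow_two]; exact hη
  constructor
  · rw [pow_mul, h2, one_pow, mul_one]
  · rw [pow_succ, pow_mul, h2, one_pow, one_mul]

/-- THE RAMIFICATION CRITERION'S CONTRADICTION (THEOREM S22.4; census b04.21): if a class is fixed by a non-residue twist, the twist law reads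
`u = u + κ` with `κ` the anisotropic 4-class; in an additive group this forces `κ = 0` — impossible for `κ_ℓ ≠ 0`, so `ℓ` cannot be a split
prime of `D(χ)`: `ℓ ∈ Ram D(χ)` (table level: `3 ∈ Ram D(η(2.A₆))`, `5 ∈ Ram D(χ₂₀(U₃(5)))`, `7 ∈ Ram D(η₂₄(SL₂(49)))`, …).
research route conditional on HC_CM; not a corollary; Q11.4-sentence-2 already refuted in dim ≥ 3. -/
theorem twistLaw_ramification_contradiction (u κ : A) (hκ : κ ≠ 0) : u ≠ u + κ := by
  intro h
  apply hκ
  have e : u + 0 = u + κ := by rw [add_zero]; exact h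
  exact (add_left_cancel e).symm

end Summit.HodgeConjecture.HodgeConjecture.Ring2.WeilCoverage
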